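import Mathlib
import Literature.NumberTheory.Transcendental.PeriodsWave0
import HarnessLib

/-!
# Zudilin's second-order Apéry-like recursion and continued fraction for `ζ(4)` (JTNB 2003, §2)

Topic `Literature/NumberTheory/Irrationality/Zudilin2003` (sub-namespace `ZetaFour`; the sibling files of this
directory formalise the author's 2003 Catalan-constant paper). Source: W. Zudilin, *Well-poised hypergeometric
service for diophantine problems of zeta values*, J. Théor. Nombres Bordeaux **15** (2003) 593–626
[Zudilin2003WellPoised], **§2 "Second-order recursion and continued fraction for ζ(4)"**. READ ON THE PAGE
(held text `paper:galaxy-pdf-1593531969313998860` = the author's preprint of 4 March 2003, chunks p0004–p0007):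

* (3)–(5): the difference equation `(n+1)⁵ u_{n+1} − b(n) u_n − 3n³(3n−1)(3n+1) u_{n−1} = 0`,
  `b(n) = 3(2n+1)(3n²+3n+1)(15n²+15n+4) = 270n⁵ + 675n⁴ + 702n³ + 378n² + 105n + 12`, with initial data
  `u₀ = 1, u₁ = 12, v₀ = 0, v₁ = 13` for its two independent solutions `u_n`, `v_n`;
* "**Theorem 1.** For each `n = 0, 1, 2, …`, the numbers `u_n` and `v_n` are positive rationals satisfying the
  inclusions (6) `6D_n u_n ∈ ℤ`, `6D_n⁵ v_n ∈ ℤ`, and there holds the limit relation (7)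
  `lim_{n→∞} v_n/u_n = π⁴/90 = ζ(4)`." — then: `lim log u_n/n = lim log v_n/n = 3 log(3+2√3) = 5.59879212…`
  and "(see [Zu1], Proposition 2)" `lim log|u_n ζ(4) − v_n|/n = 3 log|3 − 2√3| = −2.30295525…`, "since the
  characteristic polynomial `λ² − 270λ − 27` of the equation (3) has zeros `135 ± 78√3 = (3 ± 2√3)³`";
* "**Theorem 2.** There holds the following continued-fraction expansion:
  `ζ(4) = 13/|b(0)| + 1⁷·2·3·4/|b(1)| + 2⁷·5·6·7/|b(2)| + ⋯ + n⁷(3n−1)(3n)(3n+1)/|b(n)| + ⋯`";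
  "Unfortunately, the linear forms `6D_n⁵(u_nζ(4) − v_n) ∈ ℤζ(4) + ℤ` do not tend to `0` as `n → ∞`."
* (10)–(11): `R_n(t) = (−1)ⁿ(2t+n)((t−1)⋯(t−n)·(t+n+1)⋯(t+2n)/(t(t+1)⋯(t+n))²)²`, `F_n = −Σ_{t≥1} R_n'(t)`;
  Lemma 1 (12): `F_n = U_nζ(5) + U_n'ζ(4) + U_n''ζ(3) + U_n'''ζ(2) − V_n`; Lemmas 2–4 (creative telescoping,
  certificate (23)); "**Lemma 5.** There holds the equality `F_n = U_n'ζ(4) − V_n`, where `D_nU_n' ∈ ℤ` and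
  `D_n⁵V_n ∈ ℤ`. The sequences `u_n := U_n'/6` and `v_n := V_n/6` satisfy the difference equation (3) and
  initial conditions (5)".

## Contents

DEFINITIONS: `b`, the two-step recursion `seq` solving (3) for `x_{n+1}`, `u = seq 1 12`, `v = seq 0 13`,
`IsSolution`, the rational function `R` (10) and the series `F` (11), the continuants `cont`/`P`/`Q` of the
continued fraction of Theorem 2 (partial numerators `a₁ = 13`, `a_{n+1} = n⁷(3n−1)(3n)(3n+1)`, partial
denominators `b(n)`).

NAMED FACTS (statements only): `theorem1_inclusions` ((6) with positivity — `v_n > 0` typed for `n ≥ 1`,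
since `v₀ = 0` by (5): the printed "for each `n = 0, 1, 2, …` … positive" over-states at `n = 0` for `v`),
`theorem1_limit` ((7)), `lemma5` (`F_n = 6(u_nζ(4) − v_n)`), `coeff_asymptotics`, `form_asymptotics`.

PROVED: `b_eq` (the expansion (4)), `seq_isSolution`/`u_isSolution`/`v_isSolution`, `u_two = 804`,
`v_two = 13923/16` (so `v₂/u₂ = 13923/12864 = 1.08232…`, `ζ(4) = 1.082323…`) with the inclusions (6) at
`n = 2` checked (`inclusions_two`), `charPoly_roots` (`(3 ± 2√3)³ = 135 ± 78√3` are the zeros of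
`λ² − 270λ − 27`), `cont_eq` (the continuants are `Q_n = n!⁵u_n`, `P_n = n!⁵v_n`), hence
`theorem2_of_theorem1`: **Theorem 2 follows from (7)** (the convergents `P_n/Q_n` equal `v_n/u_n`).

NOT typed: §§3–6 (the general forms `F(h)`, Bailey's transform, the group of order 51840, the Denominator
Conjecture — OPEN, not Literature — and the conditional Theorem 3, superseded unconditionally by
Marcovecchio–Zudilin 2020, tree `MarcovecchioZudilin2020.zetaFour_irrationalityExponent_le`); §7 (the `ζ(5)`
third-order recursion, Theorem 4 = tree `Zudilin2002/Recursion.lean`); §8 (Theorem 5 = tree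
`Zudilin2002/WellPoisedIntegrals.lean`); the "experimental" inclusions `u_n ∈ ℤ`, `D_n⁴v_n ∈ ℤ`,
`Φ_n^{-1}u_n ∈ ℤ` after Lemma 5 (cf. tree `KrattenthalerRivoal2007/DenominatorsTheorem.lean`, Zudilin's `ζ(4)` cell
`(4,2,1,1)`). WHAT THIS IS NOT: nothing about `ζ(5)`; the forms `u_nζ(4) − v_n` do not even prove `ζ(4) ∉ ℚ`.
-/

noncomputable section

open Filter Topology Finset

open scoped Nat

namespace Literature.NumberTheory.Irrationality.Zudilin2003.ZetaFour

open Literature.NumberTheory.Transcendental (zetaValue)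

/-! ### The difference equation (3)–(5) -/

/-- `b(n) = 3(2n+1)(3n²+3n+1)(15n²+15n+4)`, eq. (4). [cite: Zudilin2003WellPoised, §2 eq. (4)] -/
def b {S : Type*} [CommRing S] (n : S) : S :=
  3 * (2 * n + 1) * (3 * n ^ 2 + 3 * n + 1) * (15 * n ^ 2 + 15 * n + 4)

/-- (4): `b(n) = 270n⁵ + 675n⁴ + 702n³ + 378n² + 105n + 12`. [cite: Zudilin2003WellPoised, §2 eq. (4)] -/
theorem b_eq {S : Type*} [CommRing S] (n : S) :
    b n = 270 * n ^ 5 + 675 * n ^ 4 + 702 * n ^ 3 + 378 * n ^ 2 + 105 * n + 12 := by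
  unfold b
  ring

/-- The coefficient `3n³(3n−1)(3n+1)` of `u_{n−1}` in (3). [cite: Zudilin2003WellPoised, §2 eq. (3)] -/
def c {S : Type*} [CommRing S] (n : S) : S :=
  3 * n ^ 3 * (3 * n - 1) * (3 * n + 1)

/-- `x` solves (3): `(n+1)⁵ x_{n+1} − b(n) x_n − 3n³(3n−1)(3n+1) x_{n−1} = 0` for all `n ≥ 1`.
[cite: Zudilin2003WellPoised, §2 eq. (3)] -/
def IsSolution (x : ℕ → ℚ) : Prop :=
  ∀ n : ℕ, 1 ≤ n → ((n : ℚ) + 1) ^ 5 * x (n + 1) - b (n : ℚ) * x n - c (n : ℚ) * x (n - 1) = 0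

/-- The solution of (3) with initial data `x₀, x₁`, by the two-step recursion
`x_{m+2} = (b(m+1) x_{m+1} + c(m+1) x_m)/(m+2)⁵`. [cite: Zudilin2003WellPoised, §2 eqs. (3), (5)] -/
def seq (x₀ x₁ : ℚ) : ℕ → ℚ
  | 0 => x₀
  | 1 => x₁
  | m + 2 => (b ((m : ℚ) + 1) * seq x₀ x₁ (m + 1) + c ((m : ℚ) + 1) * seq x₀ x₁ m) / ((m : ℚ) + 2) ^ 5

/-- `seq x₀ x₁` solves (3). [cite: Zudilin2003WellPoised, §2 eq. (3)] -/
theorem seq_isSolution (x₀ x₁ : ℚ) : IsSolution (seq x₀ x₁) := by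
  intro n hn
  obtain ⟨m, rfl⟩ : ∃ m, n = m + 1 := ⟨n - 1, by omega⟩
  simp only [Nat.add_sub_cancel, seq]
  have hm : ((m : ℚ) + 2) ^ 5 ≠ 0 := by positivity
  push_cast
  rw [show ((m : ℚ) + 1 + 1) = (m : ℚ) + 2 by ring, mul_div_cancel₀ _ hm]
  ring

/-- `u_n`: the solution of (3) with `u₀ = 1, u₁ = 12` (5). [cite: Zudilin2003WellPoised, §2 eq. (5)] -/
def u : ℕ → ℚ := seq 1 12

/-- `v_n`: the solution of (3) with `v₀ = 0, v₁ = 13` (5). [cite: Zudilin2003WellPoised, §2 eq. (5)] -/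
def v : ℕ → ℚ := seq 0 13

/-- `u` solves (3). [cite: Zudilin2003WellPoised, §2 eqs. (3), (5)] -/
theorem u_isSolution : IsSolution u := seq_isSolution 1 12

/-- `v` solves (3). [cite: Zudilin2003WellPoised, §2 eqs. (3), (5)] -/
theorem v_isSolution : IsSolution v := seq_isSolution 0 13

/-- `u₂ = 804` (from `32u₂ = b(1)·12 + 24·1 = 2142·12 + 24`). [cite: Zudilin2003WellPoised, §2 eqs. (3)–(5)] -/
theorem u_two : u 2 = 804 := by
  norm_num [u, seq, b, c]

/-- `v₂ = 13923/16` (from `32v₂ = 2142·13`); `v₂/u₂ = 13923/12864 = 1.082322…` against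
`ζ(4) = 1.082323…`. [cite: Zudilin2003WellPoised, §2 eqs. (3)–(5)] -/
theorem v_two : v 2 = 13923 / 16 := by
  norm_num [v, seq, b, c]

/-- The inclusions (6) at `n = 2` (`D₂ = 2`): `6D₂u₂ = 9648`, `6D₂⁵v₂ = 167076` are integers.
[cite: Zudilin2003WellPoised, Theorem 1 (6)] -/
theorem inclusions_two : 6 * (2 : ℚ) * u 2 = (9648 : ℤ) ∧ 6 * (2 : ℚ) ^ 5 * v 2 = (167076 : ℤ) := by
  rw [u_two, v_two]
  norm_num

/-- **Theorem 1, inclusions (6)** (Zudilin 2003): `u_n`, `v_n` are positive rationals (`v_n` for `n ≥ 1`;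
`v₀ = 0` by (5)) with `6D_n u_n ∈ ℤ` and `6D_n⁵ v_n ∈ ℤ`, `D_n = lcm(1,…,n)` (`Nat.lcmUpto`). Named fact
(statement only). [cite: Zudilin2003WellPoised, Theorem 1 (6)] -/
def theorem1_inclusions : Prop :=
  ∀ n : ℕ, 0 < u n ∧ (1 ≤ n → 0 < v n) ∧
    (∃ z : ℤ, 6 * (Nat.lcmUpto n : ℚ) * u n = z) ∧ ∃ z : ℤ, 6 * (Nat.lcmUpto n : ℚ) ^ 5 * v n = z

/-- **Theorem 1, limit (7)** (Zudilin 2003): `lim_{n→∞} v_n/u_n = π⁴/90 = ζ(4)`. Named fact (statement only).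
[cite: Zudilin2003WellPoised, Theorem 1 (7)] -/
def theorem1_limit : Prop :=
  Tendsto (fun n : ℕ => ((v n / u n : ℚ) : ℝ)) atTop (𝓝 (zetaValue 4))

/-- The coefficient asymptotics after Theorem 1 ("Application of Poincaré's theorem then yields"):
`lim log u_n/n = lim log v_n/n = 3 log(3 + 2√3) = 5.59879212…`. Named fact (statement only).
[cite: Zudilin2003WellPoised, §2 (display after Theorem 1)] -/
def coeff_asymptotics : Prop :=
  Tendsto (fun n : ℕ => Real.log (u n : ℝ) / n) atTop (𝓝 (3 * Real.log (3 + 2 * Real.sqrt 3))) ∧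
    Tendsto (fun n : ℕ => Real.log (v n : ℝ) / n) atTop (𝓝 (3 * Real.log (3 + 2 * Real.sqrt 3)))

/-- The form asymptotics after Theorem 1 ("see [Zu1], Proposition 2"):
`lim log|u_n ζ(4) − v_n|/n = 3 log|3 − 2√3| = −2.30295525…`. Named fact (statement only).
[cite: Zudilin2003WellPoised, §2 (display after Theorem 1)] -/
def form_asymptotics : Prop :=
  Tendsto (fun n : ℕ => Real.log |(u n : ℝ) * zetaValue 4 - v n| / n) atTop
    (𝓝 (3 * Real.log |3 - 2 * Real.sqrt 3|))

/-- The characteristic polynomial `λ² − 270λ − 27` of (3) has the zeros `135 ± 78√3 = (3 ± 2√3)³`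
(`s` any square root of `3`). [cite: Zudilin2003WellPoised, §2 (sentence after Theorem 1)] -/
theorem charPoly_roots (s : ℝ) (hs : s ^ 2 = 3) :
    (135 + 78 * s) ^ 2 - 270 * (135 + 78 * s) - 27 = 0 ∧ (3 + 2 * s) ^ 3 = 135 + 78 * s ∧
      (135 - 78 * s) ^ 2 - 270 * (135 - 78 * s) - 27 = 0 ∧ (3 - 2 * s) ^ 3 = 135 - 78 * s := by
  refine ⟨?_, ?_, ?_, ?_⟩
  · linear_combination (6084 : ℝ) * hs
  · linear_combination (8 * s + 36) * hs
  · linear_combination (6084 : ℝ) * hs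
  · linear_combination (-(8 : ℝ) * s + 36) * hs

/-! ### The well-poised series (10)–(11) and Lemma 5 -/

/-- `R_n(t) = (−1)ⁿ(2t+n)((t−1)⋯(t−n)·(t+n+1)⋯(t+2n)/(t(t+1)⋯(t+n))²)²`, eq. (10).
[cite: Zudilin2003WellPoised, §2 eq. (10)] -/
def R (n : ℕ) (t : ℝ) : ℝ :=
  (-1) ^ n * (2 * t + n) *
    ((∏ j ∈ range n, (t - (j + 1))) * (∏ j ∈ range n, (t + n + (j + 1))) /
      (∏ j ∈ range (n + 1), (t + j)) ^ 2) ^ 2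

/-- `F_n = −Σ_{t=1}^{∞} R_n'(t)`, eq. (11) (written over `t = m + 1`, `m ≥ 0`).
[cite: Zudilin2003WellPoised, §2 eq. (11)] -/
def F (n : ℕ) : ℝ := -∑' m : ℕ, deriv (R n) ((m : ℝ) + 1)

/-- **Lemma 5** with the normalisation after it: `F_n = U_n'ζ(4) − V_n`, `u_n = U_n'/6`, `v_n = V_n/6`, i.e.
`F_n = 6(u_n ζ(4) − v_n)` (the `ζ(5), ζ(3), ζ(2)` coefficients of Lemma 1 vanish). Named fact (statement only).
[cite: Zudilin2003WellPoised, Lemma 5 (and the sentence after it)] -/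
def lemma5 : Prop :=
  ∀ n : ℕ, F n = 6 * ((u n : ℝ) * zetaValue 4 - v n)

/-! ### Theorem 2: the continued fraction -/

/-- The partial numerators of the continued fraction of Theorem 2 in position `n + 1` (`n ≥ 1`):
`a_{n+1} = n⁷(3n−1)(3n)(3n+1)`; `a₁ = 13` is the leading numerator. [cite: Zudilin2003WellPoised, Theorem 2] -/
def cfNum (n : ℚ) : ℚ := n ^ 7 * (3 * n - 1) * (3 * n) * (3 * n + 1)

/-- The continuants of `13/(b(0) + a₂/(b(1) + a₃/(b(2) + ⋯)))`: `y₀, y₁` given, `y_{m+2} = b(m+1) y_{m+1} +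
a_{m+2} y_m`. [cite: Zudilin2003WellPoised, Theorem 2] -/
def cont (y₀ y₁ : ℚ) : ℕ → ℚ
  | 0 => y₀
  | 1 => y₁
  | m + 2 => b ((m : ℚ) + 1) * cont y₀ y₁ (m + 1) + cfNum ((m : ℚ) + 1) * cont y₀ y₁ m

/-- Numerators of the convergents: `P₀ = 0`, `P₁ = 13`. [cite: Zudilin2003WellPoised, Theorem 2] -/
def P : ℕ → ℚ := cont 0 13

/-- Denominators of the convergents: `Q₀ = 1`, `Q₁ = b(0) = 12`. [cite: Zudilin2003WellPoised, Theorem 2] -/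
def Q : ℕ → ℚ := cont 1 12

/-- The continuants are `n!⁵` times the solutions of (3): `cont y₀ y₁ n = n!⁵ · seq y₀ y₁ n` (the equivalence
transformation turning (3) into the continued fraction of Theorem 2: `a_{n+1} = n⁵ · 3n³(3n−1)(3n+1)`).
[cite: Zudilin2003WellPoised, Theorem 2 ("making the equivalent transform of the fraction")] -/
theorem cont_eq (y₀ y₁ : ℚ) (n : ℕ) : cont y₀ y₁ n = (n ! : ℚ) ^ 5 * seq y₀ y₁ n := by
  induction n using Nat.strong_induction_on with
  | _ n ih =>
    match n with
    | 0 => simp [cont, seq]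
    | 1 => simp [cont, seq]
    | m + 2 =>
      rw [cont, ih (m + 1) (by omega), ih m (by omega), seq]
      have hm : ((m : ℚ) + 2) ^ 5 ≠ 0 := by positivity
      have hf1 : (((m + 1)! : ℕ) : ℚ) = ((m : ℚ) + 1) * (m ! : ℚ) := by
        rw [Nat.factorial_succ]; push_cast; ring
      have hf2 : (((m + 2)! : ℕ) : ℚ) = ((m : ℚ) + 2) * ((m : ℚ) + 1) * (m ! : ℚ) := by
        rw [Nat.factorial_succ, Nat.factorial_succ]; push_cast; ring
      rw [hf1, hf2]
      field_simp
      unfold cfNum c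
      ring

/-- `Q_n = n!⁵ u_n`, `P_n = n!⁵ v_n`. [cite: Zudilin2003WellPoised, Theorem 2] -/
theorem P_eq_Q_eq (n : ℕ) : P n = (n ! : ℚ) ^ 5 * v n ∧ Q n = (n ! : ℚ) ^ 5 * u n :=
  ⟨cont_eq 0 13 n, cont_eq 1 12 n⟩

/-- The convergents of Theorem 2's continued fraction are `v_n/u_n`.
[cite: Zudilin2003WellPoised, Theorem 2 ("we can consider v_n/u_n as convergents of a continued fraction for ζ(4)")] -/
theorem convergent_eq (n : ℕ) : P n / Q n = v n / u n := by
  rw [(P_eq_Q_eq n).1, (P_eq_Q_eq n).2]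
  have hf : ((n ! : ℚ)) ^ 5 ≠ 0 := by positivity
  rw [mul_div_mul_left _ _ hf]

/-- **Theorem 2** (Zudilin 2003) **from Theorem 1 (7)**: the continued fraction
`13/|b(0)| + 1⁷·2·3·4/|b(1)| + 2⁷·5·6·7/|b(2)| + ⋯ + n⁷(3n−1)(3n)(3n+1)/|b(n)| + ⋯` converges to `ζ(4)` — its
convergents `P_n/Q_n` tend to `ζ(4)`. [cite: Zudilin2003WellPoised, Theorem 2] -/
theorem theorem2_of_theorem1 (h : theorem1_limit) :
    Tendsto (fun n : ℕ => ((P n / Q n : ℚ) : ℝ)) atTop (𝓝 (zetaValue 4)) := by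
  simp_rw [convergent_eq]
  exact h

end Literature.NumberTheory.Irrationality.Zudilin2003.ZetaFour
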